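import Mathlib
import HarnessLib
import Summits.Ventures.LatticeQCDFlow.Scoring.GaussianShiftedBallMonotone

/-!
# THE SHIFTED-BALL PROBABILITY `F_c(κ) = N^{⊗ι}{(z_{r₁} + κ)² + Σ_{r ≠ r₀, r₁} z_r² ≤ c}` IS A
# CONTINUOUS, STRICTLY DECREASING FUNCTION OF `κ ≥ 0` (`c > 0`) — HENCE EVERY TARGET ACCEPTANCE
# PROBABILITY `β ∈ (0, F_c(0))` IS ATTAINED AT EXACTLY ONE NON-CENTRALITY `κ_β > 0`
# (the DETECTABLE EFFECT SIZE of the `k`-arm homogeneity test at power `1 − β`)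

HONEST FRAMING: exact (Metropolis-corrected) sampling algorithms for lattice gauge theory;
figures of merit are autocorrelation/cost numbers at stated couplings and volumes; no
continuum-physics claim.

Venture `LatticeQCDFlow` (cell pub-lqcd), topic `Scoring`; FANOUT row 4 (`s0-u1-b`, GEN-34).
NEW WORK of the cell (classical), no definition, nothing cited as a fact (the non-central `χ²`
quantile / "detectable effect size" NAMED ONLY).

WHY (row 4).  `Scoring/KArmHomogeneityLocalPower` (GEN-34) identifies the limiting acceptance
probability of the `k`-arm homogeneity test under local alternatives with `F_c(κ)`,
`κ² = Σ_r (h_r − h̄_w)²/s_r`, and `Scoring/GaussianShiftedBallMonotone` shows `F_c` is non-increasing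
on `[0, ∞)` with `F_c(κ) → 0`.  To turn "how large a discrepancy between implementations does the
test detect with probability `1 − β`?" into a well-posed number one needs MORE: continuity and STRICT
decrease.  This file proves both — `F_c` is an integral of the one-dimensional section probability
`N(0,1){t | (t + κ)² ≤ c − Σ_{r ≠ r₀, r₁} x_r²}` against `N^{⊗ι}` (**`pi_gaussianReal_shiftedBall_eq_integral`**),
the section is continuous in `κ` and STRICTLY decreasing on `[0, ∞)` whenever its threshold is
positive (**`strictAntiOn_gaussianReal_real_Icc_symm`**), the set of `x` with positive threshold
is open, non-empty and therefore charged by the Gaussian product (`IsOpenPosMeasure`) — so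
**`continuous_pi_gaussianReal_shiftedBall`**, **`pi_gaussianReal_shiftedBall_strictAntiOn`**, and by
the intermediate value theorem **`pi_gaussianReal_shiftedBall_threshold_existsUnique`**: for `c > 0`
and every `β` with `0 < β < F_c(0)` there is exactly one `κ ≥ 0` with `F_c(κ) = β`, and it is `> 0`.

## Content

* §1 (one dimension) `continuous_gaussianReal_real_Icc_symm`, **`strictAntiOn_gaussianReal_real_Icc_symm`**
  (`z > 0`), `continuous_gaussianReal_real_sqShift`, `gaussianReal_real_sqShift_lt` (strict for `ρ > 0`),
  `measurable_gaussianReal_real_sqShift_comp`.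
* §2 (the ball) `lintegral_pi_eq_lintegral_lmarginal_singleton` (integrate one coordinate first),
  **`pi_gaussianReal_shiftedBall_eq_lintegral`** / **`pi_gaussianReal_shiftedBall_eq_integral`**,
  **`continuous_pi_gaussianReal_shiftedBall`**, `pi_gaussianReal_sumSq_lt_pos` (the Gaussian product
  charges `{Σ_{r ≠ r₀, r₁} x_r² < c}`), **`pi_gaussianReal_shiftedBall_strictAntiOn`** (`c > 0`).
* §3 **`pi_gaussianReal_shiftedBall_threshold_existsUnique`**.

NOT CLAIMED: the value of `κ_β` (a non-central `χ²` quantile — numerical); joint monotonicity in `c`;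
anything chain-level.
-/

open MeasureTheory ProbabilityTheory Filter Topology Finset
open scoped ENNReal

namespace Summit.Ventures.LatticeQCDFlow.Scoring

open Set

/-! ## §1 One dimension -/

section OneDim

/-- `δ ↦ N(δ,1)([−z, z])` is continuous (`z ≥ 0`). -/
theorem continuous_gaussianReal_real_Icc_symm {z : ℝ} (hz : 0 ≤ z) :
    Continuous fun δ : ℝ => (gaussianReal δ 1).real (Icc (-z) z) :=
  continuous_iff_continuousAt.2 fun δ => (hasDerivAt_gaussianReal_real_Icc_symm hz δ).continuousAt

/-- For `z > 0`, `δ > 0`: `φ(−z − δ) < φ(z − δ)` strictly. -/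
theorem gaussianPDFReal_neg_sub_lt {z δ : ℝ} (hz : 0 < z) (hδ : 0 < δ) :
    gaussianPDFReal 0 1 (-z - δ) < gaussianPDFReal 0 1 (z - δ) := by
  rw [CardConsistency.gaussianPDFReal_std_eq, CardConsistency.gaussianPDFReal_std_eq]
  refine mul_lt_mul_of_pos_left (Real.exp_lt_exp.2 ?_) (by positivity)
  have : (z - δ) ^ 2 < (-z - δ) ^ 2 := by nlinarith
  linarith

/-- **`δ ↦ N(δ,1)([−z, z])` IS STRICTLY DECREASING ON `[0, ∞)`** for `z > 0`. [ours] -/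
theorem strictAntiOn_gaussianReal_real_Icc_symm {z : ℝ} (hz : 0 < z) :
    StrictAntiOn (fun δ : ℝ => (gaussianReal δ 1).real (Icc (-z) z)) (Ici 0) := by
  have hderiv := hasDerivAt_gaussianReal_real_Icc_symm hz.le
  refine strictAntiOn_of_deriv_neg (convex_Ici 0)
    (fun δ _ => (hderiv δ).continuousAt.continuousWithinAt) ?_
  intro δ hδ
  rw [interior_Ici, Set.mem_Ioi] at hδ
  rw [(hderiv δ).deriv]
  have := gaussianPDFReal_neg_sub_lt hz hδ
  linarith

/-- `κ ↦ N(0,1){t | (t + κ)² ≤ ρ}` is continuous (every `ρ`). [ours] -/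
theorem continuous_gaussianReal_real_sqShift (ρ : ℝ) :
    Continuous fun κ : ℝ => (gaussianReal 0 1).real {t : ℝ | (t + κ) ^ 2 ≤ ρ} := by
  simp only [gaussianReal_real_sqShift_le]
  split_ifs with hρ
  · exact continuous_gaussianReal_real_Icc_symm (Real.sqrt_nonneg ρ)
  · exact continuous_const

/-- **Strict decrease of the section for a positive threshold**: `0 ≤ κ < κ'`, `ρ > 0` ⇒
`N(0,1){(t + κ')² ≤ ρ} < N(0,1){(t + κ)² ≤ ρ}`. [ours] -/
theorem gaussianReal_real_sqShift_lt {κ κ' ρ : ℝ} (hκ : 0 ≤ κ) (hlt : κ < κ') (hρ : 0 < ρ) :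
    (gaussianReal 0 1).real {t : ℝ | (t + κ') ^ 2 ≤ ρ}
      < (gaussianReal 0 1).real {t : ℝ | (t + κ) ^ 2 ≤ ρ} := by
  simp only [gaussianReal_real_sqShift_le, if_pos hρ.le]
  exact strictAntiOn_gaussianReal_real_Icc_symm (Real.sqrt_pos.2 hρ) (Set.mem_Ici.2 hκ)
    (Set.mem_Ici.2 (hκ.trans hlt.le)) hlt

/-- `ρ ↦ N(0,1){(t + κ)² ≤ ρ}` is monotone, hence measurable; so is its composition with a
measurable threshold. -/
theorem monotone_gaussianReal_real_sqShift (κ : ℝ) :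
    Monotone fun ρ : ℝ => (gaussianReal 0 1).real {t : ℝ | (t + κ) ^ 2 ≤ ρ} := by
  intro ρ ρ' h
  exact measureReal_mono (fun t (ht : (t + κ) ^ 2 ≤ ρ) => ht.trans h)

/-- `x ↦ N(0,1){(t + κ)² ≤ T x}` is measurable for a measurable threshold `T`. -/
theorem measurable_gaussianReal_real_sqShift_comp {α : Type*} [MeasurableSpace α] (κ : ℝ)
    {T : α → ℝ} (hT : Measurable T) :
    Measurable fun x : α => (gaussianReal 0 1).real {t : ℝ | (t + κ) ^ 2 ≤ T x} :=
  (monotone_gaussianReal_real_sqShift κ).measurable.comp hT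

end OneDim

/-! ## §2 The shifted ball: integral representation, continuity, strict decrease -/

section Ball

variable {ι : Type*} [Fintype ι] [DecidableEq ι]

omit [DecidableEq ι] in
/-- **Integrate one coordinate first**: for probability factors and measurable `f`,
`∫⁻ f d(⊗μ) = ∫⁻ x, (∫⋯∫⁻_{i} f ∂μ) x d(⊗μ)`. [ours] -/
theorem lintegral_pi_eq_lintegral_lmarginal_singleton [DecidableEq ι] (μ : ι → Measure ℝ)
    [∀ i, IsProbabilityMeasure (μ i)] (i : ι) {f : (ι → ℝ) → ℝ≥0∞} (hf : Measurable f) :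
    ∫⁻ x, f x ∂(Measure.pi μ) = ∫⁻ x, (∫⋯∫⁻_{i}, f ∂μ) x ∂(Measure.pi μ) := by
  refine lintegral_eq_of_lmarginal_eq {i} hf (hf.lmarginal μ) ?_
  funext y
  have h1 : (∫⋯∫⁻_{i}, (∫⋯∫⁻_{i}, f ∂μ) ∂μ) y
      = ∫⁻ t, (∫⋯∫⁻_{i}, f ∂μ) (Function.update y i t) ∂(μ i) := by
    rw [lmarginal_singleton (∫⋯∫⁻_{i}, f ∂μ) i]
  rw [h1]
  simp_rw [lmarginal_update_of_mem μ (Finset.mem_singleton_self i)]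
  rw [lintegral_const, measure_univ, mul_one]

/-- **`N^{⊗ι}{(z_{r₁} + κ)² + Σ_{r ≠ r₀, r₁} z_r² ≤ c} = ∫⁻ x, N(0,1){t | (t + κ)² ≤ c − Σ_{r ≠ r₀, r₁} x_r²} dN^{⊗ι}(x)`.** [ours] -/
theorem pi_gaussianReal_shiftedBall_eq_lintegral (r₀ r₁ : ι) (κ c : ℝ) :
    (Measure.pi fun _ : ι => gaussianReal 0 1)
        {z : ι → ℝ | (z r₁ + κ) ^ 2 + ∑ r ∈ (univ.erase r₀).erase r₁, z r ^ 2 ≤ c}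
      = ∫⁻ x, (gaussianReal 0 1) {t : ℝ | (t + κ) ^ 2 ≤ c - ∑ r ∈ (univ.erase r₀).erase r₁, x r ^ 2}
          ∂(Measure.pi fun _ : ι => gaussianReal 0 1) := by
  rw [← lintegral_indicator_one (measurableSet_shiftedBall r₀ r₁ κ c),
    lintegral_pi_eq_lintegral_lmarginal_singleton (fun _ : ι => gaussianReal 0 1) r₁
      (measurable_one.indicator (measurableSet_shiftedBall r₀ r₁ κ c))]
  refine lintegral_congr fun x => ?_
  have h := lmarginal_shiftedBall_singleton (r₀ := r₀) (r₁ := r₁) κ (measurableSet_Iic (a := c)) x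
  simp only [Set.mem_Iic] at h
  rw [h, setOf_sqShift_add_le]

/-- Real-valued (Bochner) form: `N^{⊗ι}{…} = ∫ x, N(0,1).real{t | (t + κ)² ≤ c − Σ_{r ≠ r₀, r₁} x_r²} dN^{⊗ι}`. [ours] -/
theorem pi_gaussianReal_shiftedBall_eq_integral (r₀ r₁ : ι) (κ c : ℝ) :
    (Measure.pi fun _ : ι => gaussianReal 0 1).real
        {z : ι → ℝ | (z r₁ + κ) ^ 2 + ∑ r ∈ (univ.erase r₀).erase r₁, z r ^ 2 ≤ c}
      = ∫ x, (gaussianReal 0 1).real {t : ℝ | (t + κ) ^ 2 ≤ c - ∑ r ∈ (univ.erase r₀).erase r₁, x r ^ 2}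
          ∂(Measure.pi fun _ : ι => gaussianReal 0 1) := by
  have hmeas : Measurable fun x : ι → ℝ =>
      (gaussianReal 0 1).real {t : ℝ | (t + κ) ^ 2 ≤ c - ∑ r ∈ (univ.erase r₀).erase r₁, x r ^ 2} :=
    measurable_gaussianReal_real_sqShift_comp κ (by fun_prop)
  rw [integral_eq_lintegral_of_nonneg_ae (Eventually.of_forall fun x => measureReal_nonneg)
    hmeas.aestronglyMeasurable, measureReal_def, pi_gaussianReal_shiftedBall_eq_lintegral]
  congr 1
  refine lintegral_congr fun x => ?_
  rw [measureReal_def, ENNReal.ofReal_toReal (measure_ne_top _ _)]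

/-- **`F_c` IS CONTINUOUS IN `κ`** (every `c`). [ours] -/
theorem continuous_pi_gaussianReal_shiftedBall (r₀ r₁ : ι) (c : ℝ) :
    Continuous fun κ : ℝ => (Measure.pi fun _ : ι => gaussianReal 0 1).real
      {z : ι → ℝ | (z r₁ + κ) ^ 2 + ∑ r ∈ (univ.erase r₀).erase r₁, z r ^ 2 ≤ c} := by
  simp only [pi_gaussianReal_shiftedBall_eq_integral]
  refine continuous_of_dominated (bound := fun _ => 1) ?_ ?_ (integrable_const 1) ?_
  · intro κ
    exact (measurable_gaussianReal_real_sqShift_comp κ (by fun_prop)).aestronglyMeasurable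
  · intro κ
    refine Eventually.of_forall fun x => ?_
    rw [Real.norm_eq_abs, abs_of_nonneg measureReal_nonneg]
    exact measureReal_le_one
  · refine Eventually.of_forall fun x => ?_
    exact continuous_gaussianReal_real_sqShift _

/-- **The Gaussian product charges `{x | Σ_{r ≠ r₀, r₁} x_r² < c}`** for `c > 0` (open, contains `0`). [ours] -/
theorem pi_gaussianReal_sumSq_lt_pos (r₀ r₁ : ι) {c : ℝ} (hc : 0 < c) :
    (Measure.pi fun _ : ι => gaussianReal 0 1)
      {x : ι → ℝ | ∑ r ∈ (univ.erase r₀).erase r₁, x r ^ 2 < c} ≠ 0 := by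
  haveI : ∀ _i : ι, (gaussianReal (0 : ℝ) 1).IsOpenPosMeasure := fun _ =>
    (gaussianReal_absolutelyContinuous' 0 one_ne_zero).isOpenPosMeasure
  have hopen : IsOpen {x : ι → ℝ | ∑ r ∈ (univ.erase r₀).erase r₁, x r ^ 2 < c} :=
    isOpen_lt (by fun_prop) continuous_const
  have hne : ({x : ι → ℝ | ∑ r ∈ (univ.erase r₀).erase r₁, x r ^ 2 < c}).Nonempty :=
    ⟨0, by simpa using hc⟩
  exact (hopen.measure_pos (Measure.pi fun _ : ι => gaussianReal 0 1) hne).ne'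

/-- **`F_c` IS STRICTLY DECREASING ON `[0, ∞)`** for `c > 0`: `0 ≤ κ < κ'` ⇒ `F_c(κ') < F_c(κ)`. [ours] -/
theorem pi_gaussianReal_shiftedBall_strictAntiOn (r₀ r₁ : ι) {c : ℝ} (hc : 0 < c) :
    StrictAntiOn (fun κ : ℝ => (Measure.pi fun _ : ι => gaussianReal 0 1).real
      {z : ι → ℝ | (z r₁ + κ) ^ 2 + ∑ r ∈ (univ.erase r₀).erase r₁, z r ^ 2 ≤ c}) (Ici 0) := by
  intro κ hκ κ' hκ' hlt
  rw [Set.mem_Ici] at hκ hκ'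
  simp only [measureReal_def]
  refine (ENNReal.toReal_lt_toReal (measure_ne_top _ _) (measure_ne_top _ _)).2 ?_
  rw [pi_gaussianReal_shiftedBall_eq_lintegral, pi_gaussianReal_shiftedBall_eq_lintegral]
  set S : (ι → ℝ) → ℝ := fun x => ∑ r ∈ (univ.erase r₀).erase r₁, x r ^ 2 with hS
  have hSm : Measurable S := by simp only [hS]; fun_prop
  have hgm : ∀ κ₀ : ℝ, Measurable fun x : ι → ℝ => (gaussianReal 0 1) {t : ℝ | (t + κ₀) ^ 2 ≤ c - S x} := by
    intro κ₀
    have h := (measurable_gaussianReal_real_sqShift_comp κ₀ (measurable_const.sub hSm) :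
      Measurable fun x : ι → ℝ => (gaussianReal 0 1).real {t : ℝ | (t + κ₀) ^ 2 ≤ c - S x})
    have e : (fun x : ι → ℝ => (gaussianReal 0 1) {t : ℝ | (t + κ₀) ^ 2 ≤ c - S x})
        = fun x => ENNReal.ofReal ((gaussianReal 0 1).real {t : ℝ | (t + κ₀) ^ 2 ≤ c - S x}) := by
      funext x; rw [measureReal_def, ENNReal.ofReal_toReal (measure_ne_top _ _)]
    rw [e]
    exact ENNReal.measurable_ofReal.comp h
  refine lintegral_strict_mono_of_ae_le_of_ae_lt_on (hgm κ).aemeasurable ?_ ?_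
    (pi_gaussianReal_sumSq_lt_pos r₀ r₁ hc) ?_
  · refine ne_of_lt (lt_of_le_of_lt (lintegral_mono fun x => prob_le_one) ?_)
    simp
  · exact Eventually.of_forall fun x => gaussianReal_sqShift_le_mono hκ hlt.le _
  · refine Eventually.of_forall fun x hx => ?_
    simp only [Set.mem_setOf_eq] at hx
    have hρ : 0 < c - S x := by simp only [hS]; linarith
    have h := gaussianReal_real_sqShift_lt hκ hlt hρ
    simp only [measureReal_def] at h
    exact (ENNReal.toReal_lt_toReal (measure_ne_top _ _) (measure_ne_top _ _)).1 h

end Ball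

/-! ## §3 The detectable effect size: a unique non-centrality for every target probability -/

section Threshold

variable {ι : Type*} [Fintype ι] [DecidableEq ι]

/-- **THE DETECTABLE EFFECT SIZE EXISTS AND IS UNIQUE.**  For `c > 0` and every `β` with
`0 < β < F_c(0)` there is exactly one `κ ≥ 0` with
`N^{⊗ι}{(z_{r₁} + κ)² + Σ_{r ≠ r₀, r₁} z_r² ≤ c} = β`, and it is positive (IVT + strict decrease;
`F_c(κ) → 0`). [ours] -/
theorem pi_gaussianReal_shiftedBall_threshold_existsUnique (r₀ r₁ : ι) {c β : ℝ} (hc : 0 < c)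
    (hβ0 : 0 < β)
    (hβ1 : β < (Measure.pi fun _ : ι => gaussianReal 0 1).real
      {z : ι → ℝ | (z r₁ + 0) ^ 2 + ∑ r ∈ (univ.erase r₀).erase r₁, z r ^ 2 ≤ c}) :
    ∃! κ : ℝ, 0 ≤ κ ∧ (Measure.pi fun _ : ι => gaussianReal 0 1).real
      {z : ι → ℝ | (z r₁ + κ) ^ 2 + ∑ r ∈ (univ.erase r₀).erase r₁, z r ^ 2 ≤ c} = β := by
  set F : ℝ → ℝ := fun κ => (Measure.pi fun _ : ι => gaussianReal 0 1).real
      {z : ι → ℝ | (z r₁ + κ) ^ 2 + ∑ r ∈ (univ.erase r₀).erase r₁, z r ^ 2 ≤ c} with hF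
  have hcont : Continuous F := continuous_pi_gaussianReal_shiftedBall r₀ r₁ c
  have hanti : StrictAntiOn F (Ici 0) := pi_gaussianReal_shiftedBall_strictAntiOn r₀ r₁ hc
  have hlim : Tendsto F atTop (𝓝 0) := tendsto_pi_gaussianReal_shiftedBall_atTop r₀ r₁ c
  -- a point where `F` is below `β`
  obtain ⟨K, hK⟩ := (hlim.eventually (gt_mem_nhds hβ0)).exists_forall_of_atTop
  set K' := max K 0 with hK'
  have hK'0 : 0 ≤ K' := le_max_right _ _
  have hFK' : F K' < β := hK K' (le_max_left _ _)
  -- IVT on `[0, K']`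
  have hivt := intermediate_value_Icc' hK'0 hcont.continuousOn
  have hβmem : β ∈ Icc (F K') (F 0) := ⟨hFK'.le, hβ1.le⟩
  obtain ⟨κ, ⟨hκ0, _⟩, hκβ⟩ := hivt hβmem
  refine ⟨κ, ⟨hκ0, hκβ⟩, ?_⟩
  rintro κ₂ ⟨hκ₂0, hκ₂β⟩
  exact (hanti.injOn (Set.mem_Ici.2 hκ₂0) (Set.mem_Ici.2 hκ0) (hκ₂β.trans hκβ.symm))

/-- The unique threshold is POSITIVE. -/
theorem pi_gaussianReal_shiftedBall_threshold_pos (r₀ r₁ : ι) {c β κ : ℝ} (hκ0 : 0 ≤ κ)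
    (hβ1 : β < (Measure.pi fun _ : ι => gaussianReal 0 1).real
      {z : ι → ℝ | (z r₁ + 0) ^ 2 + ∑ r ∈ (univ.erase r₀).erase r₁, z r ^ 2 ≤ c})
    (hκβ : (Measure.pi fun _ : ι => gaussianReal 0 1).real
      {z : ι → ℝ | (z r₁ + κ) ^ 2 + ∑ r ∈ (univ.erase r₀).erase r₁, z r ^ 2 ≤ c} = β) :
    0 < κ := by
  rcases hκ0.lt_or_eq with h | h
  · exact h
  · exfalso
    rw [← h] at hκβ
    exact absurd hκβ (ne_of_gt hβ1)

end Threshold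

end Summit.Ventures.LatticeQCDFlow.Scoring
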